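import Summits.CriticalPhenomena.PercolationContinuityZ3.Theorems.PercNearOneGluingNoHeavyQuantTwoBigChain
import Mathlib.Tactic.LinearCombination
import HarnessLib

/-!
# QUANT lane R8, Conjecture DIB\* — the two-big certificate, cell `LL/C2, block B1hi`

builds on p205010 (kernel theorem, internal audit signed; external expert review pending)

Support file (`--supports stmt-CriticalPhenomena-4575`), QUANT lane census-1 (gen 17); memo
`run/shared/lean/prim/quant/prim-quant-census-1/TWOBIG-G17.md`.  Theorems only, no definitions, no sorries, standard axioms.
Coordinates `y = 1 − x`, `uᵢ = αᵢφᵢ`, `vᵢ = αᵢ(1 − φᵢ)` (`αᵢ = bᵢ/j`, `φᵢ` = credit rate of big `i`); the three `tbcBlock_*` lemmas are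
LP-found Handelman certificates (products of the cell's defining inequalities, replayed by `linarith`) of a separable budget split
`c₁ + c₂ + c₀ = (1−y)α₁α₂ − P₁P₂`, `cₖ·Dₖ ≤ Bₖ·Nₖ`; `tbcCell_*` combines them into the reduced inequality of the cell
(items in product form).  [this work]; the gluing rows served [cite: KozmaNitzan2024, Conjecture 3 (p. 15)].
-/

namespace Summit.CriticalPhenomena.PercolationContinuityZ3.Theorems

namespace Quant

namespace IndepBlob

set_option maxHeartbeats 3000000 in
set_option maxRecDepth 8192 in
/-- Two-big cell `LL/C2`, block 1: Handelman support (273 products; kit LP; split polynomial rounded to denominators ≤ 256). [this work] -/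
theorem tbcBlock_LL_C2_hi_1 (y u₁ v₁ u₂ v₂ : ℝ) (_hy : 0 ≤ y) (_hhy : 0 ≤ 1 / 2 - y) (_hu1 : 0 ≤ u₁) (_hv1 : 0 ≤ v₁) (_hu2 : 0 ≤ u₂)
    (_hv2 : 0 ≤ v₂) (_ha1 : 0 ≤ 1 - u₁ - v₁) (_hb1 : 0 ≤ u₁ + v₁ - 1 / 2) (_ha2 : 0 ≤ 1 - u₂ - v₂) (_hb2 : 0 ≤ u₂ + v₂ - 1 / 2)
    (_ht1 : 0 ≤ (1 - y) * v₁ - u₁ * y) (_ht2 : 0 ≤ (1 - y) * v₂ - u₂ * y) (_hc1 : 0 ≤ 1 - (2 - u₁ - u₂))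
    (_hr1 : 0 ≤ (2 - u₁ - u₂) - (2 - y) * (1 - u₁ - v₁)) (_hr2 : 0 ≤ (2 - u₁ - u₂) - (2 - y) * (1 - u₂ - v₂)) (_hsub : 0 ≤ y - 1 / 4) :
    (13 / 64 * y + 3 / 64 * u₁ + 99 / 256 * v₁ + 89 / 256 * v₂ + 125 / 256 * y ^ 2 - 239 / 256 * y * u₁ - 133 / 128 * y * v₁ - 59 / 128 * y * u₂ - 225 / 256 * y * v₂ + 19 / 128 * u₁ ^ 2
          + 1 / 8 * u₁ * v₁ + 51 / 128 * u₁ * u₂ + 201 / 256 * u₁ * v₂ - 1 / 128 * v₁ ^ 2 + 7 / 32 * v₁ * u₂ + 93 / 128 * v₁ * v₂ - 21 / 256 * u₂ ^ 2 - 67 / 256 * u₂ * v₂ - 1 / 32 * v₂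
          ^ 2) * (y * (2 - u₁ - u₂) + (1 + v₁ - u₂) ^ 2)
      ≤ (((u₁ + v₁) * (1 - y) ^ 2 + y * u₁) * ((u₂ + v₂) * (2 - y) - u₂)) * (1 + v₁ - u₂) ^ 2 := by
  linarith [
    mul_nonneg (mul_nonneg (mul_nonneg (mul_nonneg _hhy _hhy) _hhy) _hv1) _hv2, mul_nonneg (mul_nonneg (mul_nonneg (mul_nonneg (mul_nonneg _hhy _hhy) _hhy) _hv1) _ha1) _ht2,
    mul_nonneg (mul_nonneg (mul_nonneg (mul_nonneg (mul_nonneg _hhy _hhy) _hhy) _hv2) _ha1) _ht1, mul_nonneg (mul_nonneg (mul_nonneg _hhy _hhy) _hhy) _ht1,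
    mul_nonneg (mul_nonneg (mul_nonneg _hhy _hhy) _hhy) _hr1, mul_nonneg (mul_nonneg (mul_nonneg (mul_nonneg _hhy _hhy) _hv1) _hv2) _ht2,
    mul_nonneg (mul_nonneg (mul_nonneg (mul_nonneg (mul_nonneg _hhy _hhy) _hv1) _ha2) _hb2) _ht1, mul_nonneg (mul_nonneg (mul_nonneg (mul_nonneg _hhy _hhy) _hv1) _ha2) _hc1,
    mul_nonneg (mul_nonneg (mul_nonneg (mul_nonneg _hhy _hhy) _hv1) _hr1) _hr2, mul_nonneg (mul_nonneg (mul_nonneg (mul_nonneg (mul_nonneg _hhy _hhy) _hv2) _hv2) _hv2) _ht1,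
    mul_nonneg (mul_nonneg (mul_nonneg (mul_nonneg (mul_nonneg _hhy _hhy) _hv2) _ha1) _hc1) _hr2, mul_nonneg (mul_nonneg (mul_nonneg _hhy _hhy) _hv2) _ht1,
    mul_nonneg (mul_nonneg (mul_nonneg (mul_nonneg _hhy _hhy) _ha1) _ht1) _ht2, mul_nonneg (mul_nonneg (mul_nonneg (mul_nonneg (mul_nonneg _hhy _hhy) _hb1) _ht2) _hc1) _hc1,
    mul_nonneg (mul_nonneg (mul_nonneg (mul_nonneg (mul_nonneg _hhy _hhy) _ha2) _ha2) _ht1) _hc1, mul_nonneg (mul_nonneg (mul_nonneg (mul_nonneg _hhy _hhy) _ha2) _hc1) _hr1,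
    mul_nonneg (mul_nonneg (mul_nonneg (mul_nonneg (mul_nonneg _hhy _hhy) _hb2) _ht1) _hc1) _hc1, mul_nonneg (mul_nonneg _hhy _hhy) _ht1,
    mul_nonneg (mul_nonneg (mul_nonneg _hhy _hhy) _ht1) _hr1, mul_nonneg (mul_nonneg (mul_nonneg _hhy _hhy) _ht1) _hr2, mul_nonneg (mul_nonneg _hhy _hhy) _ht2,
    mul_nonneg (mul_nonneg (mul_nonneg _hhy _hhy) _ht2) _hr1, mul_nonneg (mul_nonneg (mul_nonneg (mul_nonneg _hhy _hhy) _hsub) _hc1) _hr1,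
    mul_nonneg (mul_nonneg (mul_nonneg (mul_nonneg _hhy _hhy) _hc1) _hc1) _hc1, mul_nonneg (mul_nonneg (mul_nonneg _hhy _hhy) _hr1) _hr2,
    mul_nonneg (mul_nonneg (mul_nonneg (mul_nonneg (mul_nonneg _hhy _hu1) _hu1) _hu1) _hu1) _hsub, mul_nonneg (mul_nonneg (mul_nonneg (mul_nonneg _hhy _hu1) _hu2) _ht2) _ht2,
    mul_nonneg (mul_nonneg (mul_nonneg (mul_nonneg _hhy _hu1) _ha2) _hr2) _hr2, mul_nonneg (mul_nonneg (mul_nonneg (mul_nonneg _hhy _hv1) _hv1) _hv1) _ht2,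
    mul_nonneg (mul_nonneg (mul_nonneg (mul_nonneg _hhy _hv1) _hv1) _ht2) _hr1, mul_nonneg (mul_nonneg (mul_nonneg (mul_nonneg _hhy _hv1) _hv2) _hv2) _ht1,
    mul_nonneg (mul_nonneg (mul_nonneg (mul_nonneg (mul_nonneg _hhy _hv1) _hv2) _ha1) _hsub) _hsub, mul_nonneg (mul_nonneg (mul_nonneg (mul_nonneg _hhy _hv1) _hv2) _ha1) _hc1,
    mul_nonneg (mul_nonneg (mul_nonneg (mul_nonneg _hhy _hv1) _hv2) _ht2) _hr1, mul_nonneg (mul_nonneg (mul_nonneg (mul_nonneg _hhy _hv1) _hv2) _hr1) _hr1,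
    mul_nonneg (mul_nonneg (mul_nonneg (mul_nonneg (mul_nonneg _hhy _hv1) _ha1) _ht2) _hsub) _hsub, mul_nonneg (mul_nonneg (mul_nonneg (mul_nonneg _hhy _hv1) _hb1) _ht2) _hr1,
    mul_nonneg (mul_nonneg (mul_nonneg (mul_nonneg (mul_nonneg _hhy _hv1) _ha2) _ha2) _hsub) _hr1, mul_nonneg (mul_nonneg (mul_nonneg (mul_nonneg _hhy _hv1) _ht2) _hsub) _hc1,
    mul_nonneg (mul_nonneg (mul_nonneg _hhy _hv1) _ht2) _hr1, mul_nonneg (mul_nonneg (mul_nonneg (mul_nonneg _hhy _hu2) _ha1) _ht1) _hr2,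
    mul_nonneg (mul_nonneg (mul_nonneg (mul_nonneg _hhy _hu2) _ha2) _ht2) _ht2, mul_nonneg (mul_nonneg (mul_nonneg (mul_nonneg _hhy _hu2) _ha2) _hr1) _hr2,
    mul_nonneg (mul_nonneg (mul_nonneg (mul_nonneg (mul_nonneg _hhy _hv2) _hv2) _hv2) _ha1) _hsub,
    mul_nonneg (mul_nonneg (mul_nonneg (mul_nonneg (mul_nonneg _hhy _hv2) _hv2) _ha2) _ht2) _hsub, mul_nonneg (mul_nonneg (mul_nonneg (mul_nonneg _hhy _hv2) _hv2) _ht1) _hr1,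
    mul_nonneg (mul_nonneg (mul_nonneg (mul_nonneg _hhy _hv2) _hv2) _hr1) _hr1, mul_nonneg (mul_nonneg (mul_nonneg (mul_nonneg _hhy _hv2) _ha1) _ht1) _ht1,
    mul_nonneg (mul_nonneg (mul_nonneg (mul_nonneg _hhy _hv2) _hb1) _ht1) _hr1, mul_nonneg (mul_nonneg (mul_nonneg (mul_nonneg _hhy _hv2) _hb1) _hr1) _hr1,
    mul_nonneg (mul_nonneg (mul_nonneg (mul_nonneg _hhy _hv2) _ha2) _ht1) _ht2, mul_nonneg (mul_nonneg (mul_nonneg _hhy _hv2) _ht1) _ht2,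
    mul_nonneg (mul_nonneg (mul_nonneg _hhy _hv2) _ht1) _hr1, mul_nonneg (mul_nonneg (mul_nonneg (mul_nonneg _hhy _ha1) _ha1) _ha1) _ha1,
    mul_nonneg (mul_nonneg (mul_nonneg (mul_nonneg (mul_nonneg (mul_nonneg _hhy _ha1) _ha1) _ha1) _ha2) _hsub) _hsub,
    mul_nonneg (mul_nonneg (mul_nonneg (mul_nonneg (mul_nonneg (mul_nonneg _hhy _ha1) _ha1) _ha1) _hsub) _hsub) _hsub, mul_nonneg (mul_nonneg _hhy _ha1) _ha2,
    mul_nonneg (mul_nonneg (mul_nonneg _hhy _ha1) _ha2) _ha2, mul_nonneg (mul_nonneg (mul_nonneg _hhy _ha1) _ht2) _hc1, mul_nonneg (mul_nonneg _hhy _ha1) _hsub,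
    mul_nonneg (mul_nonneg (mul_nonneg (mul_nonneg (mul_nonneg _hhy _ha1) _hsub) _hc1) _hc1) _hr2, mul_nonneg (mul_nonneg (mul_nonneg (mul_nonneg _hhy _ha1) _hc1) _hr2) _hr2,
    mul_nonneg (mul_nonneg (mul_nonneg (mul_nonneg (mul_nonneg _hhy _hb1) _hb1) _hb1) _ht1) _hsub, mul_nonneg (mul_nonneg (mul_nonneg (mul_nonneg _hhy _hb1) _ha2) _ht1) _hr2,
    mul_nonneg (mul_nonneg (mul_nonneg (mul_nonneg (mul_nonneg _hhy _hb1) _ha2) _ht2) _hsub) _hc1, mul_nonneg (mul_nonneg (mul_nonneg (mul_nonneg _hhy _ha2) _ha2) _ha2) _ha2,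
    mul_nonneg (mul_nonneg (mul_nonneg (mul_nonneg (mul_nonneg _hhy _ha2) _ha2) _ht2) _hsub) _hc1,
    mul_nonneg (mul_nonneg (mul_nonneg (mul_nonneg (mul_nonneg _hhy _ha2) _ha2) _hsub) _hsub) _hr2, mul_nonneg (mul_nonneg (mul_nonneg (mul_nonneg _hhy _ha2) _ha2) _hsub) _hr1,
    mul_nonneg (mul_nonneg (mul_nonneg (mul_nonneg _hhy _ha2) _ha2) _hc1) _hc1, mul_nonneg (mul_nonneg (mul_nonneg (mul_nonneg _hhy _ha2) _hb2) _ht1) _ht1,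
    mul_nonneg (mul_nonneg (mul_nonneg (mul_nonneg _hhy _ha2) _ht2) _hc1) _hr2, mul_nonneg (mul_nonneg _hhy _ha2) _hsub,
    mul_nonneg (mul_nonneg (mul_nonneg (mul_nonneg (mul_nonneg _hhy _ha2) _hsub) _hc1) _hc1) _hr1, mul_nonneg (mul_nonneg (mul_nonneg (mul_nonneg _hhy _ha2) _hc1) _hr1) _hr1,
    mul_nonneg (mul_nonneg (mul_nonneg (mul_nonneg _hhy _hb2) _hsub) _hc1) _hr1, mul_nonneg (mul_nonneg (mul_nonneg (mul_nonneg _hhy _hb2) _hc1) _hc1) _hc1,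
    mul_nonneg (mul_nonneg (mul_nonneg (mul_nonneg _hhy _ht1) _ht2) _hc1) _hc1, mul_nonneg (mul_nonneg (mul_nonneg _hhy _ht1) _hsub) _hc1,
    mul_nonneg (mul_nonneg (mul_nonneg _hhy _ht1) _hr1) _hr1, mul_nonneg (mul_nonneg (mul_nonneg _hhy _ht1) _hr1) _hr2, mul_nonneg (mul_nonneg _hhy _ht1) _hr2,
    mul_nonneg (mul_nonneg (mul_nonneg _hhy _ht2) _hsub) _hc1, mul_nonneg (mul_nonneg (mul_nonneg (mul_nonneg _hhy _ht2) _hsub) _hc1) _hr1,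
    mul_nonneg (mul_nonneg (mul_nonneg (mul_nonneg _hhy _ht2) _hc1) _hc1) _hc1, mul_nonneg (mul_nonneg _hhy _ht2) _hr1, mul_nonneg (mul_nonneg (mul_nonneg _hhy _ht2) _hr1) _hr1,
    mul_nonneg (mul_nonneg _hhy _ht2) _hr2, mul_nonneg (mul_nonneg _hhy _hsub) _hsub, mul_nonneg (mul_nonneg (mul_nonneg _hhy _hsub) _hc1) _hc1,
    mul_nonneg (mul_nonneg (mul_nonneg (mul_nonneg _hhy _hc1) _hc1) _hc1) _hc1, mul_nonneg (mul_nonneg (mul_nonneg _hhy _hr1) _hr1) _hr2,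
    mul_nonneg (mul_nonneg (mul_nonneg (mul_nonneg _hu1 _hu1) _hu1) _hsub) _hr1, mul_nonneg (mul_nonneg (mul_nonneg _hu1 _hu1) _ha1) _ht1,
    mul_nonneg (mul_nonneg (mul_nonneg _hu1 _hu1) _ht1) _hr2, mul_nonneg (mul_nonneg (mul_nonneg _hu1 _hu1) _ht2) _hsub, mul_nonneg (mul_nonneg (mul_nonneg _hu1 _hv1) _hv1) _hc1,
    mul_nonneg (mul_nonneg (mul_nonneg _hu1 _hv1) _hv2) _hv2, mul_nonneg (mul_nonneg (mul_nonneg _hu1 _hv1) _hv2) _ht2, mul_nonneg (mul_nonneg (mul_nonneg _hu1 _hv2) _hv2) _hr2,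
    mul_nonneg (mul_nonneg (mul_nonneg _hu1 _hv2) _ht2) _hr2, mul_nonneg (mul_nonneg (mul_nonneg _hu1 _hv2) _hr1) _hr1, mul_nonneg (mul_nonneg (mul_nonneg _hu1 _ha1) _ha1) _ha1,
    mul_nonneg (mul_nonneg (mul_nonneg (mul_nonneg (mul_nonneg (mul_nonneg _hu1 _ha1) _hb1) _hsub) _hsub) _hsub) _hc1, mul_nonneg (mul_nonneg _hu1 _ha1) _ha2,
    mul_nonneg (mul_nonneg _hu1 _ha1) _ht1, mul_nonneg (mul_nonneg (mul_nonneg _hu1 _ha2) _ha2) _hsub, mul_nonneg (mul_nonneg (mul_nonneg _hu1 _ha2) _hb2) _ht1,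
    mul_nonneg (mul_nonneg _hu1 _ha2) _hr2, mul_nonneg (mul_nonneg (mul_nonneg _hu1 _ha2) _hr2) _hr2, mul_nonneg (mul_nonneg (mul_nonneg _hu1 _ht1) _hsub) _hc1,
    mul_nonneg (mul_nonneg _hu1 _ht1) _hr2, mul_nonneg _hu1 _ht2, mul_nonneg (mul_nonneg (mul_nonneg _hu1 _ht2) _hr1) _hr2, mul_nonneg (mul_nonneg (mul_nonneg _hu1 _hc1) _hc1) _hc1,
    mul_nonneg (mul_nonneg (mul_nonneg _hu1 _hr1) _hr1) _hr2, mul_nonneg (mul_nonneg (mul_nonneg _hv1 _hv1) _hv1) _hv1,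
    mul_nonneg (mul_nonneg (mul_nonneg (mul_nonneg _hv1 _hv1) _hv1) _hv1) _hsub, mul_nonneg (mul_nonneg (mul_nonneg (mul_nonneg (mul_nonneg _hv1 _hv1) _hv1) _hv1) _hsub) _hsub,
    mul_nonneg (mul_nonneg (mul_nonneg _hv1 _hv1) _hv1) _ha2, mul_nonneg (mul_nonneg (mul_nonneg (mul_nonneg _hv1 _hv1) _hv1) _hsub) _hsub,
    mul_nonneg (mul_nonneg (mul_nonneg (mul_nonneg _hv1 _hv1) _hv1) _hsub) _hr1, mul_nonneg (mul_nonneg (mul_nonneg _hv1 _hv1) _hu2) _hb1,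
    mul_nonneg (mul_nonneg (mul_nonneg (mul_nonneg _hv1 _hv1) _hv2) _ha1) _hsub, mul_nonneg (mul_nonneg (mul_nonneg (mul_nonneg _hv1 _hv1) _hv2) _hsub) _hsub,
    mul_nonneg (mul_nonneg (mul_nonneg _hv1 _hv1) _hv2) _hc1, mul_nonneg (mul_nonneg (mul_nonneg (mul_nonneg (mul_nonneg _hv1 _hv1) _ha1) _ht2) _hsub) _hsub,
    mul_nonneg (mul_nonneg (mul_nonneg (mul_nonneg _hv1 _hv1) _ha2) _hsub) _hr1, mul_nonneg (mul_nonneg (mul_nonneg _hv1 _hv1) _hb2) _hc1,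
    mul_nonneg (mul_nonneg (mul_nonneg (mul_nonneg _hv1 _hv1) _ht2) _hsub) _hc1, mul_nonneg (mul_nonneg (mul_nonneg (mul_nonneg _hv1 _hv1) _hsub) _hsub) _hr1,
    mul_nonneg (mul_nonneg (mul_nonneg (mul_nonneg _hv1 _hv1) _hsub) _hr1) _hr1, mul_nonneg (mul_nonneg (mul_nonneg (mul_nonneg _hv1 _hu2) _ht1) _hsub) _hr2,
    mul_nonneg (mul_nonneg (mul_nonneg _hv1 _hv2) _hv2) _hc1, mul_nonneg (mul_nonneg (mul_nonneg (mul_nonneg (mul_nonneg _hv1 _hv2) _ha1) _ht1) _hsub) _hsub,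
    mul_nonneg (mul_nonneg (mul_nonneg (mul_nonneg _hv1 _hv2) _ha1) _hsub) _hr1, mul_nonneg (mul_nonneg (mul_nonneg _hv1 _hv2) _ht1) _ht1,
    mul_nonneg (mul_nonneg (mul_nonneg (mul_nonneg _hv1 _hv2) _hsub) _hsub) _hr1, mul_nonneg (mul_nonneg (mul_nonneg _hv1 _hv2) _hc1) _hr1,
    mul_nonneg (mul_nonneg (mul_nonneg (mul_nonneg (mul_nonneg _hv1 _ha1) _ha1) _ha1) _hsub) _hsub,
    mul_nonneg (mul_nonneg (mul_nonneg (mul_nonneg (mul_nonneg (mul_nonneg _hv1 _ha1) _ha1) _ha2) _hsub) _hsub) _hsub, mul_nonneg (mul_nonneg (mul_nonneg _hv1 _ha1) _ha1) _hc1,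
    mul_nonneg (mul_nonneg (mul_nonneg (mul_nonneg (mul_nonneg _hv1 _ha1) _hsub) _hsub) _hsub) _hsub, mul_nonneg (mul_nonneg (mul_nonneg (mul_nonneg _hv1 _hb1) _ht2) _hsub) _hc1,
    mul_nonneg (mul_nonneg (mul_nonneg (mul_nonneg _hv1 _hb1) _hsub) _hsub) _hr1, mul_nonneg (mul_nonneg (mul_nonneg (mul_nonneg _hv1 _ha2) _hsub) _hsub) _hc1,
    mul_nonneg (mul_nonneg (mul_nonneg (mul_nonneg _hv1 _ha2) _hsub) _hr1) _hr1, mul_nonneg (mul_nonneg (mul_nonneg _hv1 _ht1) _ht1) _ht2,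
    mul_nonneg (mul_nonneg (mul_nonneg _hv1 _ht1) _ht1) _hr1, mul_nonneg (mul_nonneg (mul_nonneg _hv1 _ht1) _ht1) _hr2, mul_nonneg (mul_nonneg _hv1 _ht2) _ht2,
    mul_nonneg (mul_nonneg (mul_nonneg _hv1 _ht2) _ht2) _hr1, mul_nonneg (mul_nonneg (mul_nonneg (mul_nonneg _hv1 _ht2) _hsub) _hc1) _hr1,
    mul_nonneg (mul_nonneg (mul_nonneg (mul_nonneg _hv1 _hsub) _hc1) _hr1) _hr2, mul_nonneg (mul_nonneg (mul_nonneg (mul_nonneg _hu2 _hu2) _hu2) _hu2) _hsub,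
    mul_nonneg (mul_nonneg (mul_nonneg (mul_nonneg (mul_nonneg _hu2 _hu2) _hu2) _ht1) _hsub) _hsub,
    mul_nonneg (mul_nonneg (mul_nonneg (mul_nonneg (mul_nonneg _hu2 _hu2) _ha1) _ht1) _hsub) _hsub,
    mul_nonneg (mul_nonneg (mul_nonneg (mul_nonneg (mul_nonneg (mul_nonneg _hu2 _hu2) _hb1) _ha2) _hsub) _hsub) _hsub,
    mul_nonneg (mul_nonneg (mul_nonneg (mul_nonneg (mul_nonneg _hu2 _hu2) _hb1) _ht2) _hsub) _hsub, mul_nonneg (mul_nonneg (mul_nonneg _hu2 _hu2) _hsub) _hr2,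
    mul_nonneg (mul_nonneg (mul_nonneg (mul_nonneg _hu2 _hv2) _ha1) _ha1) _hsub, mul_nonneg (mul_nonneg (mul_nonneg _hu2 _hv2) _ha1) _ha2,
    mul_nonneg (mul_nonneg (mul_nonneg (mul_nonneg (mul_nonneg _hu2 _ha1) _ha2) _ht2) _hsub) _hsub,
    mul_nonneg (mul_nonneg (mul_nonneg (mul_nonneg (mul_nonneg _hu2 _ha1) _ht2) _hsub) _hsub) _hsub,
    mul_nonneg (mul_nonneg (mul_nonneg (mul_nonneg (mul_nonneg _hu2 _hb1) _hb1) _ht1) _hsub) _hsub, mul_nonneg (mul_nonneg (mul_nonneg (mul_nonneg _hu2 _hb1) _ht1) _ht2) _hsub,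
    mul_nonneg _hu2 _ha2, mul_nonneg (mul_nonneg (mul_nonneg (mul_nonneg (mul_nonneg (mul_nonneg _hu2 _ha2) _ha2) _hsub) _hsub) _hsub) _hc1,
    mul_nonneg (mul_nonneg (mul_nonneg (mul_nonneg (mul_nonneg _hu2 _ha2) _ha2) _hsub) _hsub) _hc1, mul_nonneg (mul_nonneg (mul_nonneg _hu2 _ha2) _hb2) _hr1,
    mul_nonneg (mul_nonneg (mul_nonneg (mul_nonneg _hv2 _hv2) _hv2) _hv2) _hsub, mul_nonneg (mul_nonneg (mul_nonneg _hv2 _hv2) _hv2) _ha1,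
    mul_nonneg (mul_nonneg (mul_nonneg (mul_nonneg (mul_nonneg _hv2 _hv2) _ha1) _ht1) _hsub) _hsub, mul_nonneg (mul_nonneg (mul_nonneg _hv2 _ha1) _ha1) _ha1,
    mul_nonneg (mul_nonneg (mul_nonneg (mul_nonneg _hv2 _ha1) _ha1) _ha1) _hsub, mul_nonneg (mul_nonneg (mul_nonneg (mul_nonneg (mul_nonneg _hv2 _ha1) _hb1) _ht1) _hsub) _hsub,
    mul_nonneg (mul_nonneg (mul_nonneg (mul_nonneg _hv2 _hb1) _ht1) _hsub) _hc1, mul_nonneg (mul_nonneg _hv2 _hb1) _ht2,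
    mul_nonneg (mul_nonneg (mul_nonneg (mul_nonneg (mul_nonneg _hv2 _hb1) _hsub) _hsub) _hsub) _hr1, mul_nonneg (mul_nonneg (mul_nonneg _hv2 _ha2) _ht1) _hc1,
    mul_nonneg (mul_nonneg (mul_nonneg (mul_nonneg _hv2 _ha2) _hsub) _hr2) _hr2, mul_nonneg (mul_nonneg (mul_nonneg _hv2 _ht1) _ht1) _ht2,
    mul_nonneg (mul_nonneg (mul_nonneg _hv2 _ht1) _ht1) _hr1, mul_nonneg (mul_nonneg (mul_nonneg _hv2 _ht1) _ht1) _hr2,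
    mul_nonneg (mul_nonneg (mul_nonneg (mul_nonneg _hv2 _ht1) _ht2) _hsub) _hc1, mul_nonneg (mul_nonneg (mul_nonneg _hv2 _ht1) _ht2) _hr1,
    mul_nonneg (mul_nonneg (mul_nonneg _hv2 _ht1) _hc1) _hr2, mul_nonneg (mul_nonneg (mul_nonneg (mul_nonneg _hv2 _ht2) _hsub) _hc1) _hr1,
    mul_nonneg (mul_nonneg (mul_nonneg _hv2 _ht2) _hr1) _hr1, mul_nonneg (mul_nonneg _hv2 _hsub) _hsub, mul_nonneg (mul_nonneg (mul_nonneg (mul_nonneg _hv2 _hsub) _hsub) _hr1) _hr1,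
    mul_nonneg (mul_nonneg (mul_nonneg _hv2 _hsub) _hc1) _hc1, mul_nonneg (mul_nonneg (mul_nonneg _hv2 _hc1) _hr1) _hr1,
    mul_nonneg (mul_nonneg (mul_nonneg (mul_nonneg _ha1 _ha1) _ha1) _ht2) _hsub,
    mul_nonneg (mul_nonneg (mul_nonneg (mul_nonneg (mul_nonneg (mul_nonneg _ha1 _ha1) _hb1) _ha2) _hsub) _hsub) _hsub,
    mul_nonneg (mul_nonneg (mul_nonneg (mul_nonneg _ha1 _ha1) _ha2) _ht2) _hsub, mul_nonneg (mul_nonneg _ha1 _ha1) _hb2, mul_nonneg (mul_nonneg (mul_nonneg _ha1 _hb1) _hb1) _ht2,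
    mul_nonneg (mul_nonneg _ha1 _hb1) _ha2, mul_nonneg (mul_nonneg (mul_nonneg (mul_nonneg (mul_nonneg _ha1 _hb1) _ha2) _hsub) _hsub) _hc1,
    mul_nonneg (mul_nonneg (mul_nonneg _ha1 _hb1) _hb2) _ht2, mul_nonneg (mul_nonneg _ha1 _hb1) _hr1, mul_nonneg (mul_nonneg (mul_nonneg _ha1 _hb1) _hr1) _hr1,
    mul_nonneg (mul_nonneg (mul_nonneg _ha1 _ha2) _ha2) _hc1, mul_nonneg (mul_nonneg (mul_nonneg _ha1 _ha2) _hsub) _hc1, mul_nonneg (mul_nonneg (mul_nonneg _ha1 _ha2) _hc1) _hr2,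
    mul_nonneg (mul_nonneg (mul_nonneg (mul_nonneg _ha1 _ht1) _ht1) _hsub) _hc1, mul_nonneg (mul_nonneg (mul_nonneg (mul_nonneg _ha1 _ht1) _hsub) _hsub) _hr2,
    mul_nonneg (mul_nonneg (mul_nonneg (mul_nonneg (mul_nonneg _ha1 _ht2) _hsub) _hsub) _hsub) _hc1, mul_nonneg (mul_nonneg (mul_nonneg _ha1 _hc1) _hc1) _hc1,
    mul_nonneg (mul_nonneg (mul_nonneg _ha1 _hc1) _hr2) _hr2, mul_nonneg (mul_nonneg _ha1 _hr1) _hr1, mul_nonneg (mul_nonneg (mul_nonneg _ha1 _hr1) _hr1) _hr1,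
    mul_nonneg (mul_nonneg (mul_nonneg (mul_nonneg _hb1 _hb1) _hb2) _hsub) _hc1, mul_nonneg (mul_nonneg (mul_nonneg (mul_nonneg (mul_nonneg _hb1 _hb1) _hsub) _hsub) _hsub) _hr1,
    mul_nonneg (mul_nonneg (mul_nonneg _hb1 _ha2) _ha2) _hr2, mul_nonneg (mul_nonneg (mul_nonneg (mul_nonneg _hb1 _ha2) _hsub) _hr1) _hr1,
    mul_nonneg (mul_nonneg (mul_nonneg _hb1 _ha2) _hc1) _hc1, mul_nonneg (mul_nonneg (mul_nonneg _hb1 _ha2) _hr1) _hr2, mul_nonneg (mul_nonneg _hb1 _ha2) _hr2,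
    mul_nonneg (mul_nonneg (mul_nonneg (mul_nonneg _hb1 _ht1) _ht2) _hsub) _hc1, mul_nonneg (mul_nonneg (mul_nonneg _hb1 _ht1) _hsub) _hc1,
    mul_nonneg (mul_nonneg (mul_nonneg (mul_nonneg _hb1 _ht1) _hsub) _hc1) _hr2, mul_nonneg (mul_nonneg (mul_nonneg (mul_nonneg _hb1 _ht2) _hsub) _hc1) _hr1,
    mul_nonneg (mul_nonneg (mul_nonneg (mul_nonneg _hb1 _hsub) _hsub) _hr1) _hr1, mul_nonneg (mul_nonneg (mul_nonneg _hb1 _hsub) _hc1) _hc1,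
    mul_nonneg (mul_nonneg (mul_nonneg _hb1 _hr1) _hr1) _hr2, mul_nonneg (mul_nonneg (mul_nonneg (mul_nonneg _ha2 _ha2) _ha2) _hsub) _hc1,
    mul_nonneg (mul_nonneg (mul_nonneg (mul_nonneg _ha2 _ha2) _ht1) _hsub) _hr1, mul_nonneg (mul_nonneg (mul_nonneg (mul_nonneg _ha2 _ha2) _hsub) _hr1) _hr1,
    mul_nonneg (mul_nonneg (mul_nonneg _ha2 _ha2) _hc1) _hr2, mul_nonneg _ha2 _hb2, mul_nonneg (mul_nonneg (mul_nonneg _ha2 _hb2) _ht1) _hc1, mul_nonneg (mul_nonneg _ha2 _hb2) _hr2,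
    mul_nonneg (mul_nonneg (mul_nonneg _ha2 _ht1) _ht1) _ht2, mul_nonneg (mul_nonneg (mul_nonneg _ha2 _ht1) _ht1) _hr2, mul_nonneg (mul_nonneg (mul_nonneg _ha2 _ht2) _ht2) _ht2,
    mul_nonneg (mul_nonneg (mul_nonneg _ha2 _hsub) _hsub) _hc1, mul_nonneg (mul_nonneg (mul_nonneg _ha2 _hsub) _hr1) _hr1, mul_nonneg _ha2 _hc1, mul_nonneg (mul_nonneg _ha2 _hc1) _hr1,
    mul_nonneg (mul_nonneg (mul_nonneg _ha2 _hc1) _hr1) _hr2, mul_nonneg (mul_nonneg _ha2 _hc1) _hr2, mul_nonneg (mul_nonneg (mul_nonneg _ha2 _hc1) _hr2) _hr2, mul_nonneg _hb2 _ht1,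
    mul_nonneg (mul_nonneg (mul_nonneg (mul_nonneg _hb2 _ht1) _hsub) _hc1) _hr1, mul_nonneg (mul_nonneg _hb2 _hsub) _hsub,
    mul_nonneg (mul_nonneg (mul_nonneg (mul_nonneg _hb2 _hsub) _hsub) _hr2) _hr2, mul_nonneg (mul_nonneg (mul_nonneg _hb2 _hsub) _hc1) _hc1,
    mul_nonneg (mul_nonneg (mul_nonneg (mul_nonneg _hb2 _hsub) _hc1) _hr1) _hr1, mul_nonneg (mul_nonneg _hb2 _hsub) _hr2, mul_nonneg (mul_nonneg _ht1 _ht1) _ht2,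
    mul_nonneg (mul_nonneg (mul_nonneg _ht1 _ht2) _hsub) _hc1, mul_nonneg _ht1 _hc1, mul_nonneg (mul_nonneg _ht1 _hc1) _hr1, mul_nonneg (mul_nonneg _ht1 _hc1) _hr2,
    mul_nonneg (mul_nonneg (mul_nonneg _ht1 _hc1) _hr2) _hr2, mul_nonneg _ht2 _ht2, mul_nonneg (mul_nonneg (mul_nonneg _ht2 _ht2) _ht2) _hsub, mul_nonneg (mul_nonneg _ht2 _ht2) _hr1,
    mul_nonneg (mul_nonneg _ht2 _ht2) _hr2, mul_nonneg (mul_nonneg (mul_nonneg _ht2 _hsub) _hc1) _hc1, mul_nonneg _ht2 _hc1, mul_nonneg (mul_nonneg (mul_nonneg _ht2 _hc1) _hc1) _hc1,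
    mul_nonneg _ht2 _hr1, mul_nonneg (mul_nonneg (mul_nonneg _hsub _hsub) _hsub) _hc1, mul_nonneg (mul_nonneg (mul_nonneg _hsub _hsub) _hr1) _hr1,
    mul_nonneg (mul_nonneg (mul_nonneg _hsub _hr2) _hr2) _hr2, mul_nonneg (mul_nonneg (mul_nonneg _hc1 _hc1) _hc1) _hr2, mul_nonneg (mul_nonneg _hc1 _hr1) _hr1,
    mul_nonneg (mul_nonneg (mul_nonneg _hc1 _hr1) _hr1) _hr1, mul_nonneg (mul_nonneg (mul_nonneg _hc1 _hr1) _hr2) _hr2, mul_nonneg (mul_nonneg (mul_nonneg _hc1 _hr2) _hr2) _hr2]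

end IndepBlob

end Quant

end Summit.CriticalPhenomena.PercolationContinuityZ3.Theorems
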